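import Literature.AlgebraicGeometry.Surfaces.K3SqrtThreeOfTranscendentalEmbedding
import HarnessLib

/-!
# A rational Hodge isometry between the TRANSCENDENTAL lattices of two projective K3 surfaces is induced
# by an algebraic cycle (Huybrechts, Comment. Math. Helv. 94 (2019), Cor. 0.4 (i) with the Witt remark
# after Thm. 0.2; Buskin, J. reine angew. Math. 755 (2019), Thm. 1.1) — NAMED FACT

Family `hodge`, layer `Literature/AlgebraicGeometry/Surfaces`. NAMED FACT (D-0014, statement only),
the TRANSCENDENTAL form of the tree's `Surfaces.Buskin2019_hodgeIsometry_algebraic` (which is stated for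
Hodge isometries of the full `H²`): consumer
`Summits/HodgeConjecture/HodgeConjecture/Theorems/MarkmanPartnerTransportPicardThreeK3SquaresSqrtSix*`
(crux `PicardThreeK3Squares`, stmt-HodgeConjecture-19652: the Hodge isometry
`(1/3)·φ₂⁻¹ ∘ √6 ∘ φ₃ : T(Y₃)_ℚ ⥲ T(Y₂)_ℚ` between the quotient surfaces of Varesco's construction).

## Source (read at this seat; locators = files of the materialised text `paper:arxiv-1705.04063`)

* [Huy19] D. Huybrechts, *Motives of isogenous K3 surfaces*, Comment. Math. Helv. 94 (2019) 445–458 =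
  arXiv:1705.04063 [`Huybrechts2019`; REFEREED]. Introduction [p0002:L12–L14, verbatim]: "Two complex
  projective K3 surface `S` and `S′` are called isogenous if there exists a Hodge isometry
  `φ : H²(S,ℚ) ⥲ H²(S′,ℚ)`, i.e. an isomorphism of `ℚ`-vector spaces compatible with the intersection
  pairing as well as the Hodge structure on both sides. Via Poincaré duality and Künneth formula, `φ`
  corresponds to a Hodge class `[φ] ∈ H^{2,2}(S × S′, ℚ)`." **Cor. 0.4 (i)** [p0003:L21–L22, verbatim]:
  "Any Hodge isometry `φ : H²(S,ℚ) ⥲ H²(S′,ℚ)` between complex projective K3 surfaces yields an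
  algebraic class `[φ] ∈ H^{2,2}(S × S′, ℚ)`." **Remark after Thm. 0.2** [p0002:L89–L90, verbatim]:
  "Note that by Witt's theorem, there exists a Hodge isometry `H²(S,ℚ) ≅ H²(S′,ℚ)` if and only if
  there exists a Hodge isometry `T(S) ⊗ ℚ ≅ T(S′) ⊗ ℚ`." (The extension constructed by Witt
  cancellation is `φ = u ⊕ v` for any rational isometry `v : NS(S)_ℚ ⥲ NS(S′)_ℚ`, so it RESTRICTS to the
  given `u` on `T(S) ⊗ ℚ`; the algebraic class `[φ]` then acts on `T(S)` as `u`.)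
* [Bus19] N. Buskin, *Every rational Hodge isometry between two K3 surfaces is algebraic*, J. reine
  angew. Math. 755 (2019) 127–150, Thm. 1.1 [`Buskin2019`] (= Cor. 0.4 (i)).

## Rendering (tree carriers) and faithfulness

`S`, `S′` projective K3 surfaces (`IsK3Surface`) with MARKINGS `(η, p, x)`, `(η′, p′, x′)` (the clauses
of `Huybrechts_K3_marking_exists`: integral classes `↔ Λ = ℤ²²`, cup product `=` K3 form `• p`, `x` the
period spanning `H^{2,0}`). "A Hodge isometry `u : T(S′) ⊗ ℚ ⥲ T(S) ⊗ ℚ`": a `ℂ`-linear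
`u : H²(S′(ℂ); ℂ) → H²(S(ℂ); ℂ)` (only its values on `T(S′) = transcendentalSubspace S′` matter) which
maps `T(S′)` ONTO `T(S)`, maps rational classes of `T(S′)` to rational classes, is ISOMETRIC there in the
markings (`(η u a · η u b) = (η′ a · η′ b)` for `a, b ∈ T(S′)`), and maps the period class `η′⁻¹(x′)`
into the period line `ℂ · η⁻¹(x)` (with rationality and isometry this is "compatible with the Hodge
structure": `(0,2) = \overline{(2,0)}`, `T^{1,1} = T ∩ {x, x̄}^⊥`). CONCLUSION: an ALGEBRAIC class
`γ ∈ N²H⁴((S ⊗ S′)(ℂ); ℂ)` whose action `fst_*(snd^*(·) ∪ γ)` (complex orientations; LITERALLY the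
expression of `Buskin2019_hodgeIsometry_algebraic`) agrees with `u` on `T(S′)`. WEAKER-OR-EQUAL THAN PRINT.
DISCHARGEABLE in the tree (M): Witt extension (`NumberTheory/QuadraticForms/WittExtensionHolds`) of
`u|_{T}` through the markings + the K3 Hodge types (`Huybrechts_K3_hodgeTypes_H2_holds`) reduce it to
`Buskin2019_hodgeIsometry_algebraic` — cf. `MarkmanPartnerTransportPicardThreeK3SquaresIsogenyInvariance`
(`hodgeConjectureFor_square_of_markedIsometry`), where exactly this derivation is carried out for `σ ∈ O(Λ_ℚ)`.

## Content and D-0026 accounting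

ONE named fact (+1; absent before: `lean search 'transcendentalHodgeIsometry|Huybrechts2019_'` finds no
transcendental form), no definition with body, no instance, no notation, no sorry (statement-only file).
-/

noncomputable section

open CategoryTheory MonoidalCategory
open Literature.AlgebraicTopology.SingularHomology

namespace Literature.AlgebraicGeometry.Surfaces

open HodgeTheory

/-- **Huybrechts 2019, Cor. 0.4 (i) with the Witt remark after Thm. 0.2 (Buskin 2019, Thm. 1.1) — a
rational Hodge isometry `T(S′)_ℚ ⥲ T(S)_ℚ` between the transcendental lattices of two projective K3
surfaces is induced on `T(S′)` by an algebraic class on `S × S′`.** Print: "Any Hodge isometry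
`φ : H²(S,ℚ) ⥲ H²(S′,ℚ)` between complex projective K3 surfaces yields an algebraic class
`[φ] ∈ H^{2,2}(S × S′, ℚ)`" and "by Witt's theorem, there exists a Hodge isometry `H²(S,ℚ) ≅ H²(S′,ℚ)`
if and only if there exists a Hodge isometry `T(S) ⊗ ℚ ≅ T(S′) ⊗ ℚ`" (the Witt extension restricts to
the given transcendental isometry). Rendering (module docstring): marked projective K3 surfaces
`(S, η, p, x)`, `(S′, η′, p′, x′)`; `u : H²(S′(ℂ); ℂ) → H²(S(ℂ); ℂ)` mapping `transcendentalSubspace S′`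
ONTO `transcendentalSubspace S`, rational there, isometric there in the markings, and carrying the period
class `η′⁻¹ x′` into `ℂ · η⁻¹ x`; conclusion: an algebraic `γ` on `S ⊗ S′` with
`u y = fst_*(snd^* y ∪ γ)` (complex orientations) for every `y ∈ transcendentalSubspace S′`. A THEOREM in
print (REFEREED; unproved in the tree; dischargeable from `Buskin2019_hodgeIsometry_algebraic` + Witt).
[cite: Huybrechts2019, Cor. 0.4 (i) (p0003:L21–L22) and the remark after Thm. 0.2 (p0002:L89–L90)]
[cite: Buskin2019, Thm. 1.1] -/
def Huybrechts2019_transcendentalHodgeIsometry_algebraic : Prop :=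
  ∀ ⦃S S' : Motives.SchemeOver ℂ⦄ (hS : IsK3Surface S) (hS' : IsK3Surface S')
    (η : complexBetti S (2 * 1) ≃ₗ[ℂ] (K3Index → ℂ)) (p : complexBetti S (2 * 2)) (x : K3Index → ℂ)
    (η' : complexBetti S' (2 * 1) ≃ₗ[ℂ] (K3Index → ℂ)) (p' : complexBetti S' (2 * 2)) (x' : K3Index → ℂ),
    (p ≠ 0 ∧ (IsIntegralClass p ∧
      (∀ q : complexBetti S (2 * 2), IsIntegralClass q → ∃ n : ℤ, q = n • p) ∧
      (∀ c : complexBetti S (2 * 1), IsIntegralClass c ↔ ∃ v : K3Index → ℤ, η c = fun i => (v i : ℂ)) ∧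
      (∀ a b : complexBetti S (2 * 1),
        cupProduct (rfl : 2 * 1 + 2 * 1 = 2 * 2) a b = k3Form (η a) (η b) • p) ∧
      IsOfHodgeType 2 S (2 * 1) 2 0 (LinearEquiv.symm η x) ∧
      (∀ τ : complexBetti S (2 * 1), IsOfHodgeType 2 S (2 * 1) 2 0 τ →
        ∃ t : ℂ, τ = t • LinearEquiv.symm η x)) ∧
      (k3Form x x = 0 ∧ 0 < (k3Form (star x) x).re ∧
        ∃ w : K3Index → ℤ, k3Form (fun i => (w i : ℂ)) x = 0 ∧ 0 < ∑ i, ∑ j, w i * k3Gram i j * w j)) →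
    (p' ≠ 0 ∧ (IsIntegralClass p' ∧
      (∀ q : complexBetti S' (2 * 2), IsIntegralClass q → ∃ n : ℤ, q = n • p') ∧
      (∀ c : complexBetti S' (2 * 1), IsIntegralClass c ↔ ∃ v : K3Index → ℤ, η' c = fun i => (v i : ℂ)) ∧
      (∀ a b : complexBetti S' (2 * 1),
        cupProduct (rfl : 2 * 1 + 2 * 1 = 2 * 2) a b = k3Form (η' a) (η' b) • p') ∧
      IsOfHodgeType 2 S' (2 * 1) 2 0 (LinearEquiv.symm η' x') ∧
      (∀ τ : complexBetti S' (2 * 1), IsOfHodgeType 2 S' (2 * 1) 2 0 τ →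
        ∃ t : ℂ, τ = t • LinearEquiv.symm η' x')) ∧
      (k3Form x' x' = 0 ∧ 0 < (k3Form (star x') x').re ∧
        ∃ w : K3Index → ℤ, k3Form (fun i => (w i : ℂ)) x' = 0 ∧ 0 < ∑ i, ∑ j, w i * k3Gram i j * w j)) →
  ∀ (u : complexBetti S' (2 * 1) →ₗ[ℂ] complexBetti S (2 * 1)),
    (∀ y ∈ transcendentalSubspace S', u y ∈ transcendentalSubspace S) →
    (∀ z ∈ transcendentalSubspace S, ∃ y ∈ transcendentalSubspace S', u y = z) →
    (∀ y ∈ transcendentalSubspace S', IsRationalClass y → IsRationalClass (u y)) →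
    (∀ a ∈ transcendentalSubspace S', ∀ b ∈ transcendentalSubspace S',
      k3Form (η (u a)) (η (u b)) = k3Form (η' a) (η' b)) →
    (∃ t : ℂ, u (LinearEquiv.symm η' x') = t • LinearEquiv.symm η x) →
  ∃ γ ∈ algebraicClasses (S ⊗ S') 2, ∀ y ∈ transcendentalSubspace S',
    u y = complexGysin complexOrientationFamily (Motives.IsSmoothProjective.tensor_holds hS.1 hS'.1) hS.1
      (SemiCartesianMonoidalCategory.fst S S') (rfl : 2 * 1 + 2 * 2 + 2 * 2 = 2 * 1 + 2 * (2 + 2))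
      (cupProduct (rfl : 2 * 1 + 2 * 2 = 2 * 1 + 2 * 2)
        (complexBetti.map (SemiCartesianMonoidalCategory.snd S S') (2 * 1) y) γ)

end Literature.AlgebraicGeometry.Surfaces

end
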